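import Literature.Computability.QuantumComplexity.MatchgateNumerics
import Literature.Computability.Complexity.CodeFPRat
import Literature.Computability.Complexity.CodeFPLists
import Literature.Computability.Complexity.CodeFPListKit
import Literature.Computability.Complexity.CodeFPStrings
import HarnessLib

/-!
# The polynomial-time machine of the matchgate simulation theorem (typed `CodeFP` program)

Topic `Literature/Computability/QuantumComplexity`, model namespace `Matchgate`. Proof
infrastructure, part IV, of the discharge of `JozsaMiyake2008_thm1` (`MatchgateSimulation.lean`):
the classical algorithm of Jozsa–Miyake's Theorem 1 written as a functional program on the codes
of the tree (`CodeFP`, `Complexity/CodeFP*.lean`), with exact rational arithmetic on dyadic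
approximations of the `SO(4)` blocks:

* `GateData = Bool × ℕ × List ℕ` (tag, symbol code, wires) with the code `gdE` that is LITERALLY
  `QGate.encode`; accessors `isAdjD`, `baseD`, `orD` (adjacency test, block base, orientation);
* `codeFP_stepL` — the sparse row update `stepL` of part III on a raw list of rationals is
  computed on codes, for a block position and sixteen block entries computed on codes;
* `stepD`, `foldRows` — one gate of the fold and the whole fold (a `CodeFP.foldl` over the
  REVERSED gate list with context `(P, N)`), whose accumulator bound is the dyadic bookkeeping
  `IsDy` / `Inv` (entries after `t` gates are `m / 2^{tP}` with `|·| ≤ 8^t`, so their codes have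
  length `O(tP)`);
* `estV` — the whole program on the view `((n, m, gates), (x, k))` of an instance: precision
  `P = k + T + 8`, the fold, the read-out `zExpL`, the rounding `roundEst`, and `0` on the empty
  register; **`codeFP_estV`**: it is computed on codes in polynomial time, for any table of block
  approximations computed on codes.

The table `look c o P` (symbol code, orientation, precision ↦ `4 × 4` rational matrix) is a
parameter here; part V (`MatchgateSimulationProofs.lean`) instantiates it with the dyadic names of
the (polynomial-time computable) rotation entries and proves correctness.

## References

* R. Jozsa, A. Miyake, *Matchgates and classical simulation of quantum circuits*, Proc. R. Soc. A
  464 (2008) 3089–3106, Thm. 1 and §4 ("the full matrix is poly-time computable").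
  [JozsaMiyake2008]
* S. Arora, B. Barak, *Computational Complexity: A Modern Approach*, CUP 2009, §1.3 (polynomial
  time is closed under composition and polynomially bounded loops). [AroraBarak2009]
-/

namespace Literature.Computability.QuantumComplexity.Matchgate

open _root_.Computability Literature.Computability.Complexity Literature.Computability.Complexity.CodeFP
  Literature.Computability.Cryptography Finset
open Literature.Algebra.EuclideanLattices (encodeRat encodeRat_injective)

/-! ### Gate data and its accessors -/

/-- The non-dependent data of a placed gate: tag (`false` = gate symbol, `true` = oracle), the
binary code of the symbol (resp. the query width), the list of wires. [cite: AroraBarak2009, §0.1 and §6.1 (descriptions of circuits)] -/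
abbrev GateData : Type := Bool × ℕ × List ℕ

/-- The code of gate data — literally the tree's `QGate.encode` (tag bit, then
`boolPair (bin code) (list of wires)`). [cite: AroraBarak2009, §6.1] -/
def gdE (d : GateData) : List Bool := d.1 :: boolPair (natE d.2.1) (listE natE d.2.2)

/-- Gate data read as its own code string. [folklore] -/
theorem codeFP_gdStr : CodeFP gdE strE gdE := transparent fun _ => rfl

/-- The tag bit is computed on codes. [folklore] -/
theorem codeFP_gdTag : CodeFP gdE bitE (fun d => d.1) := by
  have h : CodeFP gdE (pairE unE strE) (fun d => (0, gdE d)) := (const gdE 0).pair codeFP_gdStr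
  exact (strGetD.comp h).congr fun d => rfl

/-- The body `(code, wires)` is computed on codes (drop the tag bit). [folklore] -/
theorem codeFP_gdBody : CodeFP gdE (pairE natE (listE natE)) (fun d => d.2) := by
  have h : CodeFP gdE (pairE unE strE) (fun d => (1, gdE d)) := (const gdE 1).pair codeFP_gdStr
  have h2 : CodeFP gdE strE (fun d => (gdE d).drop 1) := (strDrop.comp h).congr fun _ => rfl
  have key : ∀ d : GateData, strE ((gdE d).drop 1) = pairE natE (listE natE) d.2 := by
    rintro ⟨t, c, ws⟩; rfl
  obtain ⟨f, hf, hspec⟩ := h2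
  exact ⟨f, hf, fun d => (hspec d).trans (key d)⟩

/-- The symbol code is computed on codes. [folklore] -/
theorem codeFP_gdCode : CodeFP gdE natE (fun d => d.2.1) := codeFP_gdBody.fst'.congr fun _ => rfl

/-- The wire list is computed on codes. [folklore] -/
theorem codeFP_gdWires : CodeFP gdE (rawE natE) (fun d => d.2.2) :=
  ((rawOfList natE).comp codeFP_gdBody.snd').congr fun _ => rfl

/-- The first wire. [folklore] -/
def wire0 (d : GateData) : ℕ := d.2.2.getD 0 0

/-- The second wire. [folklore] -/
def wire1 (d : GateData) : ℕ := d.2.2.getD 1 0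

/-- `wire0` is computed on codes. [folklore] -/
theorem codeFP_wire0 : CodeFP gdE natE wire0 :=
  ((rawGetD natE natE_zero).comp (codeFP_gdWires.pair (const gdE 0))).congr fun _ => rfl

/-- `wire1` is computed on codes. [folklore] -/
theorem codeFP_wire1 : CodeFP gdE natE wire1 :=
  ((rawGetD natE natE_zero).comp (codeFP_gdWires.pair (const gdE 1))).congr fun _ => rfl

/-- **The nearest-neighbour test on gate data**: a gate symbol on exactly two wires `a, b` with
`a + 1 = b` or `b + 1 = a`. [cite: JozsaMiyake2008, Thm 1 (i)] -/
def isAdjD (d : GateData) : Bool :=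
  !d.1 && (decide (d.2.2.length = 2) && (decide (wire0 d + 1 = wire1 d) || decide (wire1 d + 1 = wire0 d)))

/-- The block base `min a b`. [folklore] -/
def baseD (d : GateData) : ℕ := min (wire0 d) (wire1 d)

/-- The orientation: `true` iff the wires are in backward order `b + 1 = a`. [folklore] -/
def orD (d : GateData) : Bool := decide (wire1 d + 1 = wire0 d)

/-- `isAdjD` is computed on codes. [folklore] -/
theorem codeFP_isAdjD : CodeFP gdE bitE isAdjD := by
  have hlen : CodeFP gdE bitE (fun d => decide (d.2.2.length = 2)) :=
    (natEq.comp (((natLength natE).comp codeFP_gdWires).pair (const gdE 2))).congr fun _ => rfl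
  have hf : CodeFP gdE bitE (fun d => decide (wire0 d + 1 = wire1 d)) :=
    (natEq.comp ((natAdd.comp (codeFP_wire0.pair (const gdE 1))).pair codeFP_wire1)).congr fun _ => rfl
  have hb : CodeFP gdE bitE (fun d => decide (wire1 d + 1 = wire0 d)) :=
    (natEq.comp ((natAdd.comp (codeFP_wire1.pair (const gdE 1))).pair codeFP_wire0)).congr fun _ => rfl
  exact (codeFP_gdTag.not.and (hlen.and (hf.or hb))).congr fun _ => rfl

/-- `baseD` is computed on codes. [folklore] -/
theorem codeFP_baseD : CodeFP gdE natE baseD := (natMin.comp (codeFP_wire0.pair codeFP_wire1)).congr fun _ => rfl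

/-- `orD` is computed on codes. [folklore] -/
theorem codeFP_orD : CodeFP gdE bitE orD :=
  (natEq.comp ((natAdd.comp (codeFP_wire1.pair (const gdE 1))).pair codeFP_wire0)).congr fun _ => rfl

/-! ### The sparse row update on codes -/

section stepL

variable {γ : Type} {eγ : γ → List Bool}

/-- The code of a row: a raw list of canonical rational codes. [folklore] -/
abbrev rowE : List ℚ → List Bool := rawE encodeRat

/-- Reading position `2J + k` of the row, with default `0`. [folklore] -/
theorem codeFP_readAt {J : γ → ℕ} (hJ : CodeFP eγ natE J) (k : ℕ) :
    CodeFP (pairE eγ rowE) encodeRat (fun t => t.2.getD (2 * J t.1 + k) 0) := by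
  have hi : CodeFP (pairE eγ rowE) natE (fun t => 2 * J t.1 + k) :=
    (natAdd.comp ((natMul.comp ((const _ 2).pair (hJ.comp (fst _ _)))).pair (const _ k))).congr fun _ => rfl
  exact ((rawGetOr encodeRat).comp ((snd _ _).pair (hi.pair (const _ 0)))).congr fun _ => rfl

/-- The new value of one block entry is computed on codes. [folklore] -/
theorem codeFP_newVal {J : γ → ℕ} {RR : γ → Matrix LIdx LIdx ℚ} (hJ : CodeFP eγ natE J)
    (hR : ∀ μ ν, CodeFP eγ encodeRat (fun c => RR c μ ν)) (ν : LIdx) :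
    CodeFP (pairE eγ rowE) encodeRat (fun t => newVal (J t.1) (RR t.1) t.2 ν) := by
  have term : ∀ μ : LIdx, CodeFP (pairE eγ rowE) encodeRat (fun t => readBlock (J t.1) t.2 μ * RR t.1 μ ν) := by
    intro μ
    refine (ratMul.comp ((codeFP_readAt hJ (2 * μ.1 + μ.2.toNat)).pair ((hR μ ν).comp (fst _ _)))).congr fun t => ?_
    simp only [readBlock]
    congr 2
    ring
  refine ((ratAdd.comp ((ratAdd.comp ((ratAdd.comp ((term (0, false)).pair (term (0, true)))).pair
    (term (1, false)))).pair (term (1, true)))).congr fun t => ?_)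
  rw [newVal, sum_lIdx]

/-- **The sparse row update `stepL` is computed on codes**, for a block position and block
entries computed on codes from a context. [cite: AroraBarak2009, §1.3] -/
theorem codeFP_stepL {J : γ → ℕ} {RR : γ → Matrix LIdx LIdx ℚ} (hJ : CodeFP eγ natE J)
    (hR : ∀ μ ν, CodeFP eγ encodeRat (fun c => RR c μ ν)) :
    CodeFP (pairE eγ rowE) rowE (fun t => stepL (J t.1) (RR t.1) t.2) := by
  have idx : ∀ k : ℕ, CodeFP (pairE eγ rowE) natE (fun t => 2 * J t.1 + k) := fun k =>
    (natAdd.comp ((natMul.comp ((const _ 2).pair (hJ.comp (fst _ _)))).pair (const _ k))).congr fun _ => rfl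
  have nv := codeFP_newVal hJ hR
  have s1 : CodeFP (pairE eγ rowE) rowE (fun t => t.2.set (2 * J t.1) (newVal (J t.1) (RR t.1) t.2 (0, false))) :=
    ((setAt encodeRat).comp ((snd _ _).pair ((idx 0).pair (nv (0, false))))).congr fun t => by simp
  have s2 : CodeFP (pairE eγ rowE) rowE (fun t => (t.2.set (2 * J t.1) (newVal (J t.1) (RR t.1) t.2 (0, false))).set
      (2 * J t.1 + 1) (newVal (J t.1) (RR t.1) t.2 (0, true))) :=
    ((setAt encodeRat).comp (s1.pair ((idx 1).pair (nv (0, true))))).congr fun _ => rfl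
  have s3 : CodeFP (pairE eγ rowE) rowE (fun t => ((t.2.set (2 * J t.1) (newVal (J t.1) (RR t.1) t.2 (0, false))).set
      (2 * J t.1 + 1) (newVal (J t.1) (RR t.1) t.2 (0, true))).set (2 * J t.1 + 2) (newVal (J t.1) (RR t.1) t.2 (1, false))) :=
    ((setAt encodeRat).comp (s2.pair ((idx 2).pair (nv (1, false))))).congr fun _ => rfl
  exact ((setAt encodeRat).comp (s3.pair ((idx 3).pair (nv (1, true))))).congr fun t => rfl

end stepL

/-! ### One gate of the fold -/

/-- The code of the accumulator: the two rows. [folklore] -/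
abbrev accE : List ℚ × List ℚ → List Bool := pairE rowE rowE

/-- **One gate of the fold** on gate data `d` at precision `P`, for a table `look` of block
approximations (symbol code, orientation, precision ↦ `4 × 4` rational matrix): on a
nearest-neighbour gate update both rows by its approximate block, otherwise do nothing.
[cite: JozsaMiyake2008, §4 eq. (8)] -/
def stepD (look : ℕ → Bool → ℕ → Matrix LIdx LIdx ℚ) (P : ℕ) (d : GateData) (acc : List ℚ × List ℚ) :
    List ℚ × List ℚ :=
  if isAdjD d then (stepL (baseD d) (look d.2.1 (orD d) P) acc.1, stepL (baseD d) (look d.2.1 (orD d) P) acc.2) else acc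

/-- A table of block approximations is computed on codes. [folklore] -/
def LookFP (look : ℕ → Bool → ℕ → Matrix LIdx LIdx ℚ) : Prop :=
  ∀ μ ν, CodeFP (pairE natE (pairE bitE unE)) encodeRat (fun x => look x.1 x.2.1 x.2.2 μ ν)

/-- **One gate of the fold is computed on codes.** [cite: AroraBarak2009, §1.3] -/
theorem codeFP_stepD {look : ℕ → Bool → ℕ → Matrix LIdx LIdx ℚ} (hlook : LookFP look) :
    CodeFP (pairE unE (pairE gdE accE)) accE (fun t => stepD look t.1 t.2.1 t.2.2) := by
  -- context `c = (P, d)`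
  have hJ : CodeFP (pairE unE gdE) natE (fun c => baseD c.2) := (codeFP_baseD.comp (snd _ _)).congr fun _ => rfl
  have hR : ∀ μ ν, CodeFP (pairE unE gdE) encodeRat (fun c => look c.2.2.1 (orD c.2) c.1 μ ν) := fun μ ν =>
    ((hlook μ ν).comp ((codeFP_gdCode.comp (snd _ _)).pair ((codeFP_orD.comp (snd _ _)).pair (fst _ _)))).congr
      fun _ => rfl
  have hs := codeFP_stepL hJ hR
  have hctx : CodeFP (pairE unE (pairE gdE accE)) (pairE unE gdE) (fun t => (t.1, t.2.1)) :=
    ((fst _ _).pair (snd _ _).fst').congr fun _ => rfl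
  have h1 : CodeFP (pairE unE (pairE gdE accE)) rowE (fun t => stepL (baseD t.2.1) (look t.2.1.2.1 (orD t.2.1) t.1) t.2.2.1) :=
    (hs.comp (hctx.pair (snd _ _).snd'.fst')).congr fun _ => rfl
  have h2 : CodeFP (pairE unE (pairE gdE accE)) rowE (fun t => stepL (baseD t.2.1) (look t.2.1.2.1 (orD t.2.1) t.1) t.2.2.2) :=
    (hs.comp (hctx.pair (snd _ _).snd'.snd')).congr fun _ => rfl
  exact ((codeFP_isAdjD.comp (snd _ _).fst').ite (h1.pair h2) (snd _ _).snd').congr fun t => by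
    simp only [stepD]

/-! ### Dyadic bookkeeping for the accumulator bound -/

/-- `q` is a dyadic rational of exponent `E`: `q = m / 2^E` for an integer `m`. [folklore] -/
def IsDy (E : ℕ) (q : ℚ) : Prop := ∃ m : ℤ, q = m / 2 ^ E

/-- `0` is dyadic. [folklore] -/
theorem IsDy.zero (E : ℕ) : IsDy E 0 := ⟨0, by simp⟩

/-- `1` is dyadic of exponent `0`. [folklore] -/
theorem IsDy.one : IsDy 0 1 := ⟨1, by simp⟩

/-- Raising the exponent. [folklore] -/
theorem IsDy.mono {E E' : ℕ} {q : ℚ} (h : IsDy E q) (hE : E ≤ E') : IsDy E' q := by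
  obtain ⟨m, rfl⟩ := h
  obtain ⟨d, rfl⟩ := Nat.exists_eq_add_of_le hE
  refine ⟨m * 2 ^ d, ?_⟩
  rw [pow_add]; push_cast; field_simp

/-- Sums of dyadics. [folklore] -/
theorem IsDy.add {E : ℕ} {a b : ℚ} (ha : IsDy E a) (hb : IsDy E b) : IsDy E (a + b) := by
  obtain ⟨m, rfl⟩ := ha; obtain ⟨m', rfl⟩ := hb
  exact ⟨m + m', by push_cast; ring⟩

/-- Products of dyadics. [folklore] -/
theorem IsDy.mul {E E' : ℕ} {a b : ℚ} (ha : IsDy E a) (hb : IsDy E' b) : IsDy (E + E') (a * b) := by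
  obtain ⟨m, rfl⟩ := ha; obtain ⟨m', rfl⟩ := hb
  exact ⟨m * m', by rw [pow_add]; push_cast; field_simp⟩

/-- Finite sums of dyadics. [folklore] -/
theorem IsDy.sum {ι : Type*} {E : ℕ} {s : Finset ι} {f : ι → ℚ} (h : ∀ i ∈ s, IsDy E (f i)) : IsDy E (∑ i ∈ s, f i) := by
  classical
  induction s using Finset.induction_on with
  | empty => simpa using IsDy.zero E
  | insert a s ha ih =>
    rw [sum_insert ha]
    exact (h a (mem_insert_self a s)).add (ih fun i hi => h i (mem_insert_of_mem hi))

/-- The denominator of a dyadic of exponent `E` is at most `2^E`. [folklore] -/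
theorem IsDy.den_le {E : ℕ} {q : ℚ} (h : IsDy E q) : q.den ≤ 2 ^ E := by
  obtain ⟨m, rfl⟩ := h
  have h1 : ((m : ℚ) / (2 : ℚ) ^ E) = Rat.divInt m ((2 : ℤ) ^ E) := by
    rw [Rat.divInt_eq_div]; push_cast; rfl
  rw [h1]
  have h2 := Rat.den_dvd m ((2 : ℤ) ^ E)
  have h3 : (((Rat.divInt m ((2 : ℤ) ^ E)).den : ℤ)) ≤ (2 : ℤ) ^ E := Int.le_of_dvd (by positivity) h2
  exact_mod_cast h3

/-- **The invariant of the fold**: after `t` gates every entry is dyadic of exponent `tP` and at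
most `8^t` in absolute value. [folklore] -/
def Inv (P t : ℕ) (l : List ℚ) : Prop := ∀ x ∈ l, IsDy (t * P) x ∧ |x| ≤ 8 ^ t

/-- The invariant weakens in `t`. [folklore] -/
theorem Inv.mono {P t t' : ℕ} {l : List ℚ} (h : Inv P t l) (ht : t ≤ t') : Inv P t' l := fun x hx =>
  ⟨(h x hx).1.mono (Nat.mul_le_mul_right _ ht), (h x hx).2.trans (pow_le_pow_right₀ (by norm_num) ht)⟩

/-- The initial rows satisfy the invariant with `t = 0`. [folklore] -/
theorem inv_unitL (P N : ℕ) (b : Bool) : Inv P 0 (unitL N b) := by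
  intro x hx
  rw [unitL] at hx
  rcases List.mem_or_eq_of_mem_set hx with hx | rfl
  · rw [List.eq_of_mem_replicate hx]; exact ⟨IsDy.zero _, by norm_num⟩
  · exact ⟨by simpa using IsDy.one, by norm_num⟩

/-- A default read of a row satisfying the invariant. [folklore] -/
theorem Inv.getD {P t : ℕ} {l : List ℚ} (h : Inv P t l) (i : ℕ) : IsDy (t * P) (l.getD i 0) ∧ |l.getD i 0| ≤ 8 ^ t := by
  rw [List.getD_eq_getElem?_getD]
  cases hl : l[i]? with
  | none => exact ⟨IsDy.zero _, by norm_num⟩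
  | some a => exact h a (List.mem_of_getElem? hl)

/-- The hypotheses on the table of block approximations: dyadic of exponent `P`, bounded by `2`.
[folklore] -/
def LookBound (look : ℕ → Bool → ℕ → Matrix LIdx LIdx ℚ) : Prop :=
  ∀ c o P μ ν, IsDy P (look c o P μ ν) ∧ |look c o P μ ν| ≤ 2

/-- **One sparse row update preserves the invariant** (new entries are `∑_{4} old · R` with
`|R| ≤ 2`, `R` dyadic of exponent `P`). [folklore] -/
theorem Inv.stepL {P t : ℕ} {l : List ℚ} (h : Inv P t l) {R : Matrix LIdx LIdx ℚ}
    (hR : ∀ μ ν, IsDy P (R μ ν) ∧ |R μ ν| ≤ 2) (j : ℕ) : Inv P (t + 1) (stepL j R l) := by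
  have hnew : ∀ ν, IsDy ((t + 1) * P) (newVal j R l ν) ∧ |newVal j R l ν| ≤ 8 ^ (t + 1) := by
    intro ν
    have hterm : ∀ μ, IsDy ((t + 1) * P) (readBlock j l μ * R μ ν) ∧ |readBlock j l μ * R μ ν| ≤ 8 ^ t * 2 := by
      intro μ
      obtain ⟨h1, h2⟩ := h.getD (2 * (j + μ.1) + μ.2.toNat)
      refine ⟨by rw [Nat.succ_mul]; exact h1.mul (hR μ ν).1, ?_⟩
      rw [abs_mul]
      exact mul_le_mul h2 (hR μ ν).2 (abs_nonneg _) (by positivity)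
    refine ⟨IsDy.sum fun μ _ => (hterm μ).1, ?_⟩
    calc |newVal j R l ν| ≤ ∑ μ : LIdx, |readBlock j l μ * R μ ν| := abs_sum_le_sum_abs _ _
      _ ≤ ∑ _μ : LIdx, (8 : ℚ) ^ t * 2 := sum_le_sum fun μ _ => (hterm μ).2
      _ = 8 ^ (t + 1) := by rw [sum_const, card_univ]; simp [pow_succ]; ring
  intro x hx
  simp only [Matchgate.stepL] at hx
  rcases List.mem_or_eq_of_mem_set hx with hx | rfl
  · rcases List.mem_or_eq_of_mem_set hx with hx | rfl
    · rcases List.mem_or_eq_of_mem_set hx with hx | rfl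
      · rcases List.mem_or_eq_of_mem_set hx with hx | rfl
        · exact h.mono (Nat.le_succ t) x hx
        · exact hnew _
      · exact hnew _
    · exact hnew _
  · exact hnew _

/-! ### The fold of the rows -/

/-- **The two rows of the total rotation, approximately**: fold `stepD` over the gate data from
the context `(P, N)` starting from the unit rows `e_{(0,X)}, e_{(0,Y)}`. (The caller supplies the
gate list REVERSED, cf. `rowVec`: the last gate acts first on the row.) [cite: JozsaMiyake2008, §4 eq. (8)] -/
def rowsFold (look : ℕ → Bool → ℕ → Matrix LIdx LIdx ℚ) (s : ℕ × ℕ) (gds : List GateData) : List ℚ × List ℚ :=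
  gds.foldl (fun acc d => stepD look s.1 d acc) (unitL s.2 false, unitL s.2 true)

/-- Invariant and lengths along the fold. [folklore] -/
theorem inv_rowsFold {look : ℕ → Bool → ℕ → Matrix LIdx LIdx ℚ} (hB : LookBound look) (s : ℕ × ℕ) (gds : List GateData) :
    Inv s.1 gds.length (rowsFold look s gds).1 ∧ Inv s.1 gds.length (rowsFold look s gds).2 ∧
      (rowsFold look s gds).1.length = 2 * s.2 ∧ (rowsFold look s gds).2.length = 2 * s.2 := by
  suffices key : ∀ (acc : List ℚ × List ℚ) (t : ℕ), Inv s.1 t acc.1 → Inv s.1 t acc.2 →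
      acc.1.length = 2 * s.2 → acc.2.length = 2 * s.2 →
      Inv s.1 (t + gds.length) (gds.foldl (fun acc d => stepD look s.1 d acc) acc).1 ∧
      Inv s.1 (t + gds.length) (gds.foldl (fun acc d => stepD look s.1 d acc) acc).2 ∧
      (gds.foldl (fun acc d => stepD look s.1 d acc) acc).1.length = 2 * s.2 ∧
      (gds.foldl (fun acc d => stepD look s.1 d acc) acc).2.length = 2 * s.2 by
    have := key (unitL s.2 false, unitL s.2 true) 0 (inv_unitL _ _ _) (inv_unitL _ _ _) (by simp [unitL]) (by simp [unitL])
    simpa [rowsFold] using this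
  induction gds with
  | nil => intro acc t h1 h2 h3 h4; simpa using ⟨h1, h2, h3, h4⟩
  | cons d gds ih =>
    intro acc t h1 h2 h3 h4
    rw [List.foldl_cons, List.length_cons, show t + (gds.length + 1) = (t + 1) + gds.length by ring]
    apply ih
    · unfold stepD; split_ifs
      · exact h1.stepL (fun μ ν => hB _ _ _ μ ν) _
      · exact h1.mono (Nat.le_succ t)
    · unfold stepD; split_ifs
      · exact h2.stepL (fun μ ν => hB _ _ _ μ ν) _
      · exact h2.mono (Nat.le_succ t)
    · unfold stepD; split_ifs <;> simp [h3]
    · unfold stepD; split_ifs <;> simp [h4]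

/-- **Code length of an entry under the invariant**: `O(tP)`. [folklore] -/
theorem length_encodeRat_le_of_inv {P t : ℕ} {x : ℚ} (h : IsDy (t * P) x ∧ |x| ≤ 8 ^ t) :
    (encodeRat x).length ≤ 3 * (t * P) + 8 * t + 16 := by
  obtain ⟨hd, hb⟩ := h
  have hden := hd.den_le
  have hb' : |x| ≤ ((8 ^ t : ℕ) : ℚ) := by exact_mod_cast hb
  have hnum := natAbs_num_le hb' hden
  have hs1 : Nat.size (2 ^ (t * P)) = t * P + 1 := Nat.size_pow
  have hs8 : Nat.size (8 ^ t) ≤ t * 4 + 1 := (size_pow_le 8 t).trans (by rw [show Nat.size 8 = 4 by rfl])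
  have h1 : Nat.size x.num.natAbs ≤ (t * 4 + 1) + (t * P + 1) :=
    (size_mono hnum).trans ((size_mul_le _ _).trans (add_le_add hs8 hs1.le))
  have h2 : Nat.size x.den ≤ t * P + 1 := (size_mono hden).trans hs1.le
  rw [length_encodeRat]
  omega

/-- Code length of a row under the invariant. [folklore] -/
theorem length_rowE_le_of_inv {P t : ℕ} {l : List ℚ} (h : Inv P t l) :
    (rowE l).length ≤ l.length * (2 * (3 * (t * P) + 8 * t + 16) + 2) := by
  rw [rowE, length_rawE]
  refine (List.sum_le_card_nsmul _ (2 * (3 * (t * P) + 8 * t + 16) + 2) fun y hy => ?_).trans (by simp)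
  obtain ⟨x, hx, rfl⟩ := List.mem_map.1 hy
  have := length_encodeRat_le_of_inv (h x hx)
  omega

/-- **The accumulator of the fold stays polynomially bounded.** [cite: AroraBarak2009, §1.3 (polynomially bounded loops)] -/
theorem length_accE_rowsFold_le {look : ℕ → Bool → ℕ → Matrix LIdx LIdx ℚ} (hB : LookBound look) (s : ℕ × ℕ)
    (l₁ l₂ : List GateData) :
    (accE (l₁.foldl (fun acc d => stepD look s.1 d acc) (unitL s.2 false, unitL s.2 true))).length ≤
      (36 * Polynomial.X ^ 3 + 72 * Polynomial.X ^ 2 + 170 * Polynomial.X + 2 : Polynomial ℕ).eval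
        (pairE (pairE unE unE) (rawE gdE) (s, l₁ ++ l₂)).length := by
  rw [← rowsFold]
  obtain ⟨P, N⟩ := s
  set L := (pairE (pairE unE unE) (rawE gdE) ((P, N), l₁ ++ l₂)).length with hL
  have hL' : L = 2 * (2 * P + N + 2) + (rawE gdE (l₁ ++ l₂)).length + 2 := by
    rw [hL, pairE_apply, length_boolPair, pairE_apply, length_boolPair, length_unE, length_unE]
    dsimp only
    omega
  have hP : P ≤ L := by omega
  have hN : N ≤ L := by omega
  have ht : l₁.length ≤ L := by
    have := length_le_length_rawE gdE (l₁ ++ l₂)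
    rw [List.length_append] at this
    omega
  obtain ⟨i1, i2, e1, e2⟩ := inv_rowsFold hB (P, N) l₁
  simp only at i1 i2 e1 e2
  have r1 := length_rowE_le_of_inv i1
  have r2 := length_rowE_le_of_inv i2
  rw [e1] at r1; rw [e2] at r2
  have hB1 : 3 * (l₁.length * P) + 8 * l₁.length + 16 ≤ 3 * L * L + 8 * L + 16 := by nlinarith
  have hrow : 2 * N * (2 * (3 * (l₁.length * P) + 8 * l₁.length + 16) + 2) ≤ 2 * L * (2 * (3 * L * L + 8 * L + 16) + 2) := by
    have := Nat.mul_le_mul (Nat.mul_le_mul_left 2 hN) (Nat.add_le_add_right (Nat.mul_le_mul_left 2 hB1) 2)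
    exact this
  rw [accE, pairE_apply, length_boolPair]
  simp only [Polynomial.eval_add, Polynomial.eval_mul, Polynomial.eval_pow, Polynomial.eval_X, Polynomial.eval_ofNat]
  nlinarith

/-- The initial rows are computed on codes from the context. [folklore] -/
theorem codeFP_unitL (b : Bool) : CodeFP (pairE unE unE) rowE (fun s => unitL s.2 b) := by
  have hrep : CodeFP (pairE unE unE) rowE (fun s => List.replicate (2 * s.2) (0 : ℚ)) :=
    ((replicateOf encodeRat).comp ((const _ (0 : ℚ)).pair (unAdd.comp ((snd _ _).pair (snd _ _))))).congr fun s => by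
      simp [two_mul]
  exact ((setAt encodeRat).comp (hrep.pair ((const _ b.toNat).pair (const _ (1 : ℚ))))).congr fun _ => rfl

/-- **The fold of the rows is computed on codes in polynomial time.** [cite: AroraBarak2009, §1.3] -/
theorem codeFP_rowsFold {look : ℕ → Bool → ℕ → Matrix LIdx LIdx ℚ} (hlook : LookFP look) (hB : LookBound look) :
    CodeFP (pairE (pairE unE unE) (rawE gdE)) accE (fun p => rowsFold look p.1 p.2) := by
  have hstep : CodeFP (pairE (pairE unE unE) (pairE gdE accE)) accE (fun t => stepD look t.1.1 t.2.1 t.2.2) :=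
    ((codeFP_stepD hlook).comp ((fst _ _).fst'.pair (snd _ _))).congr fun _ => rfl
  have hinit : CodeFP (pairE unE unE) accE (fun s => (unitL s.2 false, unitL s.2 true)) :=
    (codeFP_unitL false).pair (codeFP_unitL true)
  exact (CodeFP.foldl (σ := ℕ × ℕ) (α := GateData) (β := List ℚ × List ℚ) (eσ := pairE unE unE) (eα := gdE)
    (eβ := accE) (step := fun s d acc => stepD look s.1 d acc) (init := fun s => (unitL s.2 false, unitL s.2 true))
    hstep hinit (36 * Polynomial.X ^ 3 + 72 * Polynomial.X ^ 2 + 170 * Polynomial.X + 2)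
    (length_accE_rowsFold_le hB)).congr fun _ => rfl

/-! ### The read-out on codes -/

/-- The code of the read-out context: the input bits and the two rows. [folklore] -/
abbrev outE : List Bool × (List ℚ × List ℚ) → List Bool := pairE strE accE

/-- **One term of the read-out `zExpL` is computed on codes.** [cite: JozsaMiyake2008, §4 eq. (10)] -/
theorem codeFP_zTerm : CodeFP (pairE outE natE) encodeRat (fun q => zTerm q.1.1 q.1.2.1 q.1.2.2 q.2) := by
  have sgnbit : CodeFP (pairE outE natE) bitE (fun q => q.1.1.getD q.2 false) :=
    (strGetDNat.comp ((fst _ _).fst'.pair (snd _ _))).congr fun _ => rfl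
  have sgn : CodeFP (pairE outE natE) encodeRat (fun q => if q.1.1.getD q.2 false then (-1 : ℚ) else 1) :=
    sgnbit.ite (const _ (-1 : ℚ)) (const _ (1 : ℚ))
  have idx : ∀ k : ℕ, CodeFP (pairE outE natE) natE (fun q => 2 * q.2 + k) := fun k =>
    (natAdd.comp ((natMul.comp ((const _ 2).pair (snd _ _))).pair (const _ k))).congr fun _ => rfl
  have r0 : ∀ k : ℕ, CodeFP (pairE outE natE) encodeRat (fun q => q.1.2.1.getD (2 * q.2 + k) 0) := fun k =>
    ((rawGetOr encodeRat).comp ((fst _ _).snd'.fst'.pair ((idx k).pair (const _ (0 : ℚ))))).congr fun _ => rfl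
  have r1 : ∀ k : ℕ, CodeFP (pairE outE natE) encodeRat (fun q => q.1.2.2.getD (2 * q.2 + k) 0) := fun k =>
    ((rawGetOr encodeRat).comp ((fst _ _).snd'.snd'.pair ((idx k).pair (const _ (0 : ℚ))))).congr fun _ => rfl
  have pa : CodeFP (pairE outE natE) encodeRat (fun q => q.1.2.1.getD (2 * q.2 + 0) 0 * q.1.2.2.getD (2 * q.2 + 1) 0) :=
    (ratMul.comp ((r0 0).pair (r1 1))).congr fun _ => rfl
  have pb : CodeFP (pairE outE natE) encodeRat (fun q => q.1.2.1.getD (2 * q.2 + 1) 0 * q.1.2.2.getD (2 * q.2 + 0) 0) :=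
    (ratMul.comp ((r0 1).pair (r1 0))).congr fun _ => rfl
  have pb' : CodeFP (pairE outE natE) encodeRat (fun q => (-1 : ℚ) * (q.1.2.1.getD (2 * q.2 + 1) 0 * q.1.2.2.getD (2 * q.2 + 0) 0)) :=
    (ratMul.comp ((const _ (-1 : ℚ)).pair pb)).congr fun _ => rfl
  have diff : CodeFP (pairE outE natE) encodeRat (fun q => q.1.2.1.getD (2 * q.2 + 0) 0 * q.1.2.2.getD (2 * q.2 + 1) 0 +
      (-1 : ℚ) * (q.1.2.1.getD (2 * q.2 + 1) 0 * q.1.2.2.getD (2 * q.2 + 0) 0)) :=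
    (ratAdd.comp (pa.pair pb')).congr fun _ => rfl
  exact (ratMul.comp (sgn.pair diff)).congr fun q => by
    simp only [zTerm, add_zero]
    ring

/-- **The read-out `zExpL` is computed on codes** (a map over `[0, N)` then an exact rational sum).
[cite: JozsaMiyake2008, §4 eq. (10)] -/
theorem codeFP_zExpL : CodeFP (pairE outE unE) encodeRat (fun p => zExpL p.1.1 p.1.2.1 p.1.2.2 p.2) := by
  have hterms : CodeFP (pairE outE (rawE natE)) (rawE encodeRat)
      (fun p => p.2.map (fun i => zTerm p.1.1 p.1.2.1 p.1.2.2 i)) :=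
    CodeFP.map (σ := List Bool × (List ℚ × List ℚ)) (α := ℕ) (g := fun q => zTerm q.1.1 q.1.2.1 q.1.2.2 q.2) codeFP_zTerm
  have hrange : CodeFP (pairE outE unE) (pairE outE (rawE natE)) (fun p => (p.1, List.range p.2)) :=
    ((fst _ _).pair (urange.comp (snd _ _))).congr fun _ => rfl
  have hterms' : CodeFP (pairE outE unE) (rawE encodeRat) (fun p => (List.range p.2).map (fun i => zTerm p.1.1 p.1.2.1 p.1.2.2 i)) :=
    (hterms.comp hrange).congr fun _ => rfl
  exact (ratSum.comp hterms').congr fun _ => rfl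

/-! ### The rounded estimate on codes -/

/-- `roundEst k z` as the floor of an explicit rational. [folklore] -/
theorem roundEst_eq_floor (k : ℕ) (z : ℚ) : roundEst k z = ⌊(2 : ℚ) ^ k * ((1 + (-1) * z) * (1 / 2)) + 1 / 2⌋ := by
  rw [roundEst, round_eq]
  congr 1
  ring

/-- **The rounded estimate is computed on codes** (`2^k` from the unary `k`, exact rational
arithmetic, floor = numerator `div` denominator). [cite: AroraBarak2009, §1.3] -/
theorem codeFP_roundEst : CodeFP (pairE unE encodeRat) smE (fun p => roundEst p.1 p.2) := by
  have twoPow : CodeFP (pairE unE encodeRat) natE (fun p => 2 ^ p.1) := (natPow.comp ((const _ 2).pair (fst _ _))).congr fun _ => rfl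
  have twoPowQ : CodeFP (pairE unE encodeRat) encodeRat (fun p => ((2 : ℚ) ^ p.1)) :=
    (ratOfIntNat.comp ((intOfNat.comp twoPow).pair (const _ 1))).congr fun p => by push_cast; simp
  have h1 : CodeFP (pairE unE encodeRat) encodeRat (fun p => (-1 : ℚ) * p.2) :=
    (ratMul.comp ((const _ (-1 : ℚ)).pair (snd _ _))).congr fun _ => rfl
  have h2 : CodeFP (pairE unE encodeRat) encodeRat (fun p => 1 + (-1 : ℚ) * p.2) :=
    (ratAdd.comp ((const _ (1 : ℚ)).pair h1)).congr fun _ => rfl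
  have h3 : CodeFP (pairE unE encodeRat) encodeRat (fun p => (1 + (-1 : ℚ) * p.2) * (1 / 2)) :=
    (ratMul.comp (h2.pair (const _ (1 / 2 : ℚ)))).congr fun _ => rfl
  have h4 : CodeFP (pairE unE encodeRat) encodeRat (fun p => (2 : ℚ) ^ p.1 * ((1 + (-1 : ℚ) * p.2) * (1 / 2))) :=
    (ratMul.comp (twoPowQ.pair h3)).congr fun _ => rfl
  have hq : CodeFP (pairE unE encodeRat) encodeRat (fun p => (2 : ℚ) ^ p.1 * ((1 + (-1) * p.2) * (1 / 2)) + 1 / 2) :=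
    (ratAdd.comp (h4.pair (const _ (1 / 2 : ℚ)))).congr fun _ => rfl
  have hnd : CodeFP (pairE unE encodeRat) (pairE intE natE) (fun p =>
      (((2 : ℚ) ^ p.1 * ((1 + (-1) * p.2) * (1 / 2)) + 1 / 2).num, ((2 : ℚ) ^ p.1 * ((1 + (-1) * p.2) * (1 / 2)) + 1 / 2).den)) :=
    (ratNumDen.comp hq).congr fun _ => rfl
  have hfl : CodeFP (pairE unE encodeRat) intE
      (fun p => ((2 : ℚ) ^ p.1 * ((1 + (-1) * p.2) * (1 / 2)) + 1 / 2).num /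
        ((((2 : ℚ) ^ p.1 * ((1 + (-1) * p.2) * (1 / 2)) + 1 / 2).den : ℕ) : ℤ)) :=
    (intEDiv.comp (hnd.fst'.pair (intOfNat.comp hnd.snd'))).congr fun _ => rfl
  exact (smOfInt.comp hfl).congr fun p => by
    rw [id, roundEst_eq_floor]
    exact Rat.floor_def'.symm

/-! ### The whole program on the view of an instance -/

/-- **The view of an instance**: `((n, m, gate data), (input bits, k))` — a fixed type whose code
`viewE` is literally `Instance.encode` (part V). [cite: AroraBarak2009, §6.1] -/
abbrev View : Type := (ℕ × ℕ × List GateData) × (List Bool × ℕ)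

/-- The code of a view: `⟨⟨bin n, ⟨1^m, gate list⟩⟩, ⟨bits, 1^k⟩⟩`. [cite: AroraBarak2009, §6.1] -/
abbrev viewE : View → List Bool := pairE (pairE natE (pairE unE (rawE gdE))) (pairE strE unE)

/-- The number of wires `N = |x| + m` of a view. [folklore] -/
def wiresV (v : View) : ℕ := v.2.1.length + v.1.2.1

/-- The precision `P = k + T + 8` of a view (`T` the number of gates). [folklore] -/
def precV (v : View) : ℕ := v.2.2 + v.1.2.2.length + 8

/-- **The classical simulation program of Jozsa–Miyake's Theorem 1** on the view of an instance:
`0` on the empty register, otherwise the rounding of `2^k (1 - Z̃)/2` where `Z̃` is the read-out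
of the two approximate rows computed at precision `P = k + T + 8` by the fold over the reversed
gate list. [cite: JozsaMiyake2008, Thm 1] -/
def estV (look : ℕ → Bool → ℕ → Matrix LIdx LIdx ℚ) (v : View) : ℤ :=
  if wiresV v = 0 then 0 else
    roundEst v.2.2 (zExpL v.2.1 (rowsFold look (precV v, wiresV v) v.1.2.2.reverse).1
      (rowsFold look (precV v, wiresV v) v.1.2.2.reverse).2 (wiresV v))

/-- **The program is computed on codes in polynomial time** (for any table of block approximations
computed on codes and dyadically bounded). [cite: AroraBarak2009, §1.3] -/
theorem codeFP_estV {look : ℕ → Bool → ℕ → Matrix LIdx LIdx ℚ} (hlook : LookFP look) (hB : LookBound look) :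
    CodeFP viewE smE (estV look) := by
  have hN : CodeFP viewE unE wiresV :=
    (unAdd.comp ((strLength.comp (snd _ _).fst').pair (fst _ _).snd'.fst')).congr fun _ => rfl
  have hP : CodeFP viewE unE precV :=
    (unAdd.comp ((unAdd.comp ((snd _ _).snd'.pair ((ulength gdE).comp (fst _ _).snd'.snd'))).pair (const _ 8))).congr
      fun _ => rfl
  have hrev : CodeFP viewE (rawE gdE) (fun v => v.1.2.2.reverse) := (rawReverse gdE).comp (fst _ _).snd'.snd'
  have hrows : CodeFP viewE accE (fun v => rowsFold look (precV v, wiresV v) v.1.2.2.reverse) :=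
    ((codeFP_rowsFold hlook hB).comp ((hP.pair hN).pair hrev)).congr fun _ => rfl
  have hz : CodeFP viewE encodeRat (fun v => zExpL v.2.1 (rowsFold look (precV v, wiresV v) v.1.2.2.reverse).1
      (rowsFold look (precV v, wiresV v) v.1.2.2.reverse).2 (wiresV v)) :=
    (codeFP_zExpL.comp (((snd _ _).fst'.pair hrows).pair hN)).congr fun _ => rfl
  have hest : CodeFP viewE smE (fun v => roundEst v.2.2 (zExpL v.2.1 (rowsFold look (precV v, wiresV v) v.1.2.2.reverse).1
      (rowsFold look (precV v, wiresV v) v.1.2.2.reverse).2 (wiresV v))) :=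
    (codeFP_roundEst.comp ((snd _ _).snd'.pair hz)).congr fun _ => rfl
  have htest : CodeFP viewE bitE (fun v => decide (wiresV v = 0)) :=
    (natEq.comp ((natOfUn.comp hN).pair (const _ 0))).congr fun _ => rfl
  exact (htest.ite (const _ (0 : ℤ)) hest).congr fun v => by
    unfold estV
    by_cases h : wiresV v = 0 <;> simp [h]

end Literature.Computability.QuantumComplexity.Matchgate
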